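/- Width seat 2/3 `ym-line-cbag-p1-w2` (prover-ym-line-cbag-p1-w2-g20-0) of the cell of ideator ym-idea-2, LINE 8
(route `EguchiKawaiDirectionLadder`), post-closure glue toward the STRONG-COUPLING side of the barrier entry
`EguchiKawaiBreakdown`.  Part 2/3 of the one-link Bakry–Émery Poincaré inequality on `SU(N)` for a GENERAL smooth tilt: the
projection argument and THM(IV) (`((Δ − W)𝒫)^⊥ = ℝ e^{S/2}`) for an arbitrary smooth potential `S` (the tree's `SUNBakryEmery`
Part G is typed for `pot c B` only).  Route-independent; YM mass gap NOT touched (barrier-ledger line). -/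
import Literature.MathematicalPhysics.QuantumFieldTheory.SUNBakryEmeryPoincare
import HarnessLib

/-!
# Bakry–Émery on `SU(N)` for a general tilt, II: the projection argument and the ground state

For a smooth `S : M_N(ℂ) → ℝ` put `W = ¼ Γ(S,S) + ½ ΔS` (the Schrödinger weight of the ground-state transform
`e^{S/2} L_S e^{−S/2} = Δ − W`, tree lemma `SUNBakryEmery.genL_groundState`).  This file proves, for ANY smooth `S` (the tree's
`exists_proj_seq` / `ae_eq_groundState_of_orthogonal` are the case `S = pot c B`, `W = schW c B`; the proofs are theirs verbatim):

* `exists_proj_seq_of_smooth` : if `w ∈ L²(σ)` is orthogonal to `(Δ − W)p` for every polynomial `p` (`W` smooth), the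
  projections `p_n` of `w` onto `𝒫_n|_{SU(N)}` satisfy `p_n → w`, `‖p_n‖ ≤ ‖w‖`, `∫ Γ(p_n,p_n) dσ = −∫ w W p_n dσ`;
* `ae_eq_groundState_of_orthogonal_smooth` (THM(IV)_S) : such a `w` is a.e. `m · e^{S/2}` — project, transform by `e^{−S/2}`,
  and use the Poincaré inequality of the Haar measure (`SUNBakryEmery.poincare_haar`); no elliptic regularity.

Nothing here depends on the curvature of `S`; Part III combines this with Part I under `CD(K,∞)`.
References: Bakry–Émery 1985; Bakry–Gentil–Ledoux (2014) §1.16, Prop. 4.8.1.  HONEST FRAMING: functional-inequality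
infrastructure on `SU(N)`; no statement about Yang–Mills, no mass gap, no summit statement is proved or advanced here.
-/

set_option autoImplicit false

noncomputable section

open scoped Matrix Matrix.Norms.Frobenius ContDiff Topology InnerProductSpace
open MeasureTheory Filter Finset
open Literature.MathematicalPhysics.QuantumFieldTheory
open Literature.MathematicalPhysics.QuantumFieldTheory.SUNBakryEmery

namespace Summit.QuantumFields.YangMills.Theorems.EguchiKawaiDirectionLadder

variable {N : ℕ}

/-- `W = ¼ Γ(S,S) + ½ ΔS` is smooth for smooth `S`. -/
theorem contDiff_schW_of_smooth {S W : Matrix (Fin N) (Fin N) ℂ → ℝ} (hS : ContDiff ℝ ∞ S)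
    (hW : W = fun Q => (1 / 4 : ℝ) * Gam S S Q + (1 / 2 : ℝ) * Lap S Q) : ContDiff ℝ ∞ W := by
  rw [hW]
  exact (contDiff_const.mul (contDiff_Gam hS hS)).add (contDiff_const.mul (contDiff_Lap hS))

/-- **The projection argument** for a smooth weight `W` (the finite-dimensional substitute for elliptic regularity; tree
`SUNBakryEmery.exists_proj_seq` with `schW c B ↦ W`): if `w ∈ L²(σ)` is orthogonal to `(Δ − W)p` for every polynomial `p`, then
the projections `p_n` of `w` onto `V_n = 𝒫_n|_{SU(N)}` satisfy `p_n → w` in `L²`, `‖p_n‖ ≤ ‖w‖`, and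
`∫ Γ(p_n,p_n) dσ = −∫ w W p_n dσ`. -/
theorem exists_proj_seq_of_smooth (hN : N ≠ 0) {W : Matrix (Fin N) (Fin N) ℂ → ℝ} (hWc : ContDiff ℝ ∞ W)
    (w : Lp ℝ 2 (haarSU N))
    (hw : ∀ n, ∀ p ∈ polySpace N n, ∫ g : SUN N, w g * (Lap p g - W g * p g) ∂(haarSU N) = 0) :
    ∃ p : ℕ → Matrix (Fin N) (Fin N) ℂ → ℝ, (∀ n, p n ∈ polySpace N n) ∧
      Tendsto (fun n => ∫ g : SUN N, (p n g - w g) ^ 2 ∂(haarSU N)) atTop (𝓝 0) ∧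
      (∀ n, ∫ g : SUN N, p n g ^ 2 ∂(haarSU N) ≤ ‖w‖ ^ 2) ∧
      ∀ n, ∫ g : SUN N, Gam (p n) (p n) g ∂(haarSU N) = -∫ g : SUN N, w g * (W g * p n g) ∂(haarSU N) := by
  -- projections
  set wn : ℕ → Lp ℝ 2 (haarSU N) := fun n => (VPoly N n).starProjection w with hwn
  have hwn_mem : ∀ n, wn n ∈ VPoly N n := fun n => by
    rw [hwn]
    simp only [Submodule.starProjection_apply]
    exact Submodule.coe_mem _
  have hq : ∀ n, ∃ q : polySpace N n, TPoly n q = wn n := fun n => LinearMap.mem_range.1 (hwn_mem n)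
  choose q hq using hq
  refine ⟨fun n => (q n).1, fun n => (q n).2, ?_, ?_, ?_⟩
  · -- convergence
    have ht : Tendsto (fun n => wn n) atTop (𝓝 w) :=
      Submodule.starProjection_tendsto_self (VPoly N) monotone_VPoly w top_le_closure_iSup_VPoly
    have ht' : Tendsto (fun n => ‖wn n - w‖ ^ 2) atTop (𝓝 0) := by
      have h1 : Tendsto (fun n => ‖wn n - w‖) atTop (𝓝 0) := tendsto_iff_norm_sub_tendsto_zero.1 ht
      simpa using h1.pow 2
    refine ht'.congr fun n => ?_
    rw [← hq n, TPoly_apply, norm_toL2_sub_sq]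
    rfl
  · -- norm bound
    intro n
    have h1 : ‖wn n‖ ≤ ‖w‖ := Submodule.norm_starProjection_apply_le (VPoly N n) w
    have h2 : ∫ g : SUN N, (q n).1 g ^ 2 ∂(haarSU N) = ‖wn n‖ ^ 2 := by
      rw [← hq n, TPoly_apply, norm_toL2_sq]; rfl
    rw [h2]
    exact pow_le_pow_left₀ (norm_nonneg _) h1 2
  · -- the identity
    intro n
    set pn : Matrix (Fin N) (Fin N) ℂ → ℝ := (q n).1 with hpn
    have hpn_mem : pn ∈ polySpace N n := (q n).2
    have hpc : ContDiff ℝ ∞ pn := contDiff_of_mem_polySpace hpn_mem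
    -- `Δ pn ∈ V_n`
    set Lq : Lp ℝ 2 (haarSU N) := TPoly n ⟨Lap pn, Lap_mem_polySpace hpn_mem⟩ with hLq
    have hLq_mem : Lq ∈ VPoly N n := ⟨_, rfl⟩
    have h1 : ⟪w - wn n, Lq⟫_ℝ = 0 := Submodule.starProjection_inner_eq_zero w Lq hLq_mem
    have h2 : ⟪wn n, Lq⟫_ℝ = -∫ g : SUN N, Gam pn pn g ∂(haarSU N) := by
      rw [← hq n, TPoly_apply, hLq, TPoly_apply, inner_toL2_toL2]
      exact integral_mul_Lap hN hpc hpc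
    have h3 : ⟪w, Lq⟫_ℝ = ∫ g : SUN N, w g * Lap pn g ∂(haarSU N) := by
      rw [real_inner_comm, hLq, TPoly_apply, inner_toL2_left]
      refine integral_congr_ae (ae_of_all _ fun g => ?_)
      simp only [resPoly_apply]
      ring
    have h4 : ⟪w, Lq⟫_ℝ = ⟪wn n, Lq⟫_ℝ := by
      have : w = (w - wn n) + wn n := by abel
      rw [this, inner_add_left, h1, zero_add]
    -- the hypothesis
    have h5 := hw n pn hpn_mem
    have hWc' : Continuous fun g : SUN N => W g * pn g :=
      (continuous_restrict hWc).mul (continuous_restrict hpc)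
    have i1 : Integrable (fun g : SUN N => w g * Lap pn g) (haarSU N) := by
      have := integrable_continuous_mul_L2 (continuous_restrict (contDiff_Lap hpc)) w
      exact this.congr (ae_of_all _ fun g => mul_comm _ _)
    have i2 : Integrable (fun g : SUN N => w g * (W g * pn g)) (haarSU N) := by
      have := integrable_continuous_mul_L2 hWc' w
      exact this.congr (ae_of_all _ fun g => mul_comm _ _)
    have h6 : ∫ g : SUN N, w g * Lap pn g ∂(haarSU N) = ∫ g : SUN N, w g * (W g * pn g) ∂(haarSU N) := by
      have : ∫ g : SUN N, w g * (Lap pn g - W g * pn g) ∂(haarSU N) =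
          ∫ g : SUN N, w g * Lap pn g ∂(haarSU N) - ∫ g : SUN N, w g * (W g * pn g) ∂(haarSU N) := by
        rw [← integral_sub i1 i2]
        exact integral_congr_ae (ae_of_all _ fun g => by ring)
      rw [this] at h5
      linarith
    linarith [h2, h3, h4, h6]

/-- **THM(IV)_S for a general smooth tilt** (tree `SUNBakryEmery.ae_eq_groundState_of_orthogonal` with `pot c B ↦ S`): if
`w ∈ L²(σ)` is orthogonal to `(Δ − W)p` for all polynomials `p`, `W = ¼Γ(S,S) + ½ΔS`, then `w = m e^{S/2}` a.e. — the ground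
state is the only `L²` solution of the Schrödinger equation: project (`exists_proj_seq_of_smooth`), transform by `e^{−S/2}`
(`∫ e^S Γ(q_n,q_n) = ∫ Γ(p_n,p_n) + ∫ W p_n² → 0`), and apply the Poincaré inequality of the Haar measure. -/
theorem ae_eq_groundState_of_orthogonal_smooth (hN : N ≠ 0) {S W : Matrix (Fin N) (Fin N) ℂ → ℝ} (hS : ContDiff ℝ ∞ S)
    (hW : W = fun Q => (1 / 4 : ℝ) * Gam S S Q + (1 / 2 : ℝ) * Lap S Q) (w : Lp ℝ 2 (haarSU N))
    (hw : ∀ n, ∀ p ∈ polySpace N n, ∫ g : SUN N, w g * (Lap p g - W g * p g) ∂(haarSU N) = 0) :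
    ∃ m : ℝ, (fun g => w g) =ᵐ[haarSU N] fun g => m * Real.exp (S g / 2) := by
  have hWc : ContDiff ℝ ∞ W := contDiff_schW_of_smooth hS hW
  have hSc : Continuous fun g : SUN N => S g := continuous_restrict hS
  obtain ⟨p, hp, hconv, hbd, hid⟩ := exists_proj_seq_of_smooth hN hWc w hw
  have hpc : ∀ n, ContDiff ℝ ∞ (p n) := fun n => contDiff_of_mem_polySpace (hp n)
  -- bounds on `e^{-S}` and `W` over the compact group
  obtain ⟨CS, hCS⟩ : ∃ C, ∀ g : SUN N, Real.exp (-S g) ≤ C := by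
    obtain ⟨C, hC⟩ := (isCompact_univ (X := SUN N)).exists_bound_of_continuousOn
      ((Real.continuous_exp.comp hSc.neg).continuousOn)
    exact ⟨C, fun g => (Real.le_norm_self _).trans (hC g (Set.mem_univ _))⟩
  have hCS0 : 0 ≤ CS := (Real.exp_pos _).le.trans (hCS 1)
  obtain ⟨CW, hCW⟩ : ∃ C, ∀ g : SUN N, |W g| ≤ C := by
    obtain ⟨C, hC⟩ := (isCompact_univ (X := SUN N)).exists_bound_of_continuousOn
      ((continuous_restrict hWc).continuousOn)
    exact ⟨C, fun g => (hC g (Set.mem_univ _))⟩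
  have hCW0 : 0 ≤ CW := (abs_nonneg _).trans (hCW 1)
  -- the transformed projections
  set q : ℕ → Matrix (Fin N) (Fin N) ℂ → ℝ := fun n Q => Real.exp (-S Q / 2) * p n Q with hqdef
  have hq : ∀ n, ContDiff ℝ ∞ (q n) := fun n => contDiff_groundState hS (hpc n)
  -- (d) the ground-state identity, integrated
  have hd : ∀ n, ∫ g : SUN N, Real.exp (S g) * Gam (q n) (q n) g ∂(haarSU N) =
      ∫ g : SUN N, Gam (p n) (p n) g ∂(haarSU N) + ∫ g : SUN N, W g * p n g ^ 2 ∂(haarSU N) := by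
    intro n
    have hpn := hpc n
    have h1 : ∫ g : SUN N, p n g ^ 2 * Lap S g ∂(haarSU N) =
        -∫ g : SUN N, 2 * (p n g * Gam S (p n) g) ∂(haarSU N) := by
      have h := integral_mul_Lap hN (F := fun Q => p n Q * p n Q) (hpn.mul hpn) hS
      have e : ∀ g : SUN N, Gam (fun Q => p n Q * p n Q) S g = 2 * (p n g * Gam S (p n) g) := fun g => by
        show Gam (p n * p n) S g = _
        rw [Gam_mul_left (F := p n) (G := p n) hpn hpn, Gam_comm (p n) S]; ring
      simp only [e] at h
      rw [← h]
      exact integral_congr_ae (ae_of_all _ fun g => by ring)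
    have i1 : Integrable (fun g : SUN N => Gam (p n) (p n) g) (haarSU N) :=
      integrable_of_continuous_SUN (continuous_restrict (contDiff_Gam hpn hpn)) _
    have i2 : Integrable (fun g : SUN N => p n g * Gam S (p n) g) (haarSU N) :=
      integrable_of_continuous_SUN ((continuous_restrict hpn).mul (continuous_restrict (contDiff_Gam hS hpn))) _
    have i3 : Integrable (fun g : SUN N => 1 / 4 * p n g ^ 2 * Gam S S g) (haarSU N) :=
      integrable_of_continuous_SUN ((continuous_const.mul ((continuous_restrict hpn).pow 2)).mul
        (continuous_restrict (contDiff_Gam hS hS))) _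
    have i4 : Integrable (fun g : SUN N => p n g ^ 2 * Lap S g) (haarSU N) :=
      integrable_of_continuous_SUN (((continuous_restrict hpn).pow 2).mul (continuous_restrict (contDiff_Lap hS))) _
    have i12 : Integrable (fun g : SUN N => Gam (p n) (p n) g - p n g * Gam S (p n) g) (haarSU N) := i1.sub i2
    calc ∫ g : SUN N, Real.exp (S g) * Gam (q n) (q n) g ∂(haarSU N)
        = ∫ g : SUN N, (Gam (p n) (p n) g - p n g * Gam S (p n) g + 1 / 4 * p n g ^ 2 * Gam S S g) ∂(haarSU N) :=
          integral_congr_ae (ae_of_all _ fun g => exp_mul_Gam_groundState hS hpn _)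
      _ = ∫ g : SUN N, Gam (p n) (p n) g ∂(haarSU N) - ∫ g : SUN N, p n g * Gam S (p n) g ∂(haarSU N) +
            ∫ g : SUN N, 1 / 4 * p n g ^ 2 * Gam S S g ∂(haarSU N) := by
          rw [integral_add i12 i3, integral_sub i1 i2]
      _ = ∫ g : SUN N, Gam (p n) (p n) g ∂(haarSU N) + ∫ g : SUN N, W g * p n g ^ 2 ∂(haarSU N) := by
          have e2 : ∫ g : SUN N, p n g * Gam S (p n) g ∂(haarSU N) =
              -(1 / 2) * ∫ g : SUN N, p n g ^ 2 * Lap S g ∂(haarSU N) := by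
            rw [h1, integral_const_mul]; ring
          have e3 : ∫ g : SUN N, W g * p n g ^ 2 ∂(haarSU N) =
              ∫ g : SUN N, 1 / 4 * p n g ^ 2 * Gam S S g ∂(haarSU N) +
                (1 / 2) * ∫ g : SUN N, p n g ^ 2 * Lap S g ∂(haarSU N) := by
            rw [← integral_const_mul, ← integral_add i3 (i4.const_mul _)]
            refine integral_congr_ae (ae_of_all _ fun g => ?_)
            rw [hW]
            ring
          rw [e2, e3]; ring
  -- (e)+(f): it tends to zero
  have hT0 : ∀ n, 0 ≤ ∫ g : SUN N, Real.exp (S g) * Gam (q n) (q n) g ∂(haarSU N) := fun n =>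
    integral_nonneg fun g => mul_nonneg (Real.exp_pos _).le (Gam_self_nonneg _ _)
  have hTle : ∀ n, ∫ g : SUN N, Real.exp (S g) * Gam (q n) (q n) g ∂(haarSU N) ≤
      CW * ‖w‖ * Real.sqrt (∫ g : SUN N, (p n g - w g) ^ 2 ∂(haarSU N)) := by
    intro n
    have hpn := hpc n
    set φ : C(SUN N, ℝ) := resCM (fun Q => W Q * p n Q)
      (continuous_restrict (hWc.mul hpn)) with hφ
    set x : Lp ℝ 2 (haarSU N) := toL2 (resPoly n ⟨p n, hp n⟩) - w with hx
    have hWp : ∫ g : SUN N, W g * p n g ^ 2 ∂(haarSU N) - ∫ g : SUN N, w g * (W g * p n g) ∂(haarSU N)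
        = ∫ g : SUN N, φ g * x g ∂(haarSU N) := by
      have i1 : Integrable (fun g : SUN N => W g * p n g ^ 2) (haarSU N) :=
        integrable_of_continuous_SUN ((continuous_restrict hWc).mul ((continuous_restrict hpn).pow 2)) _
      have i2 : Integrable (fun g : SUN N => w g * (W g * p n g)) (haarSU N) := by
        have := integrable_continuous_mul_L2 ((continuous_restrict hWc).mul (continuous_restrict hpn)) w
        exact this.congr (ae_of_all _ fun g => mul_comm _ _)
      rw [← integral_sub i1 i2]
      refine integral_congr_ae ?_
      filter_upwards [Lp.coeFn_sub (toL2 (resPoly n ⟨p n, hp n⟩)) w,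
        ContinuousMap.coeFn_toLp (p := 2) (μ := haarSU N) (𝕜 := ℝ) (resPoly n ⟨p n, hp n⟩)] with g hsub hres
      rw [hx, hsub, Pi.sub_apply, hres, resPoly_apply, hφ]
      simp only [resCM, ContinuousMap.coe_mk]
      ring
    have hcs := abs_integral_mul_L2_le φ x
    have hφbd : Real.sqrt (∫ g : SUN N, φ g ^ 2 ∂(haarSU N)) ≤ CW * ‖w‖ := by
      have h2 : ∫ g : SUN N, φ g ^ 2 ∂(haarSU N) ≤ CW ^ 2 * ∫ g : SUN N, p n g ^ 2 ∂(haarSU N) := by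
        rw [← integral_const_mul]
        refine integral_mono (integrable_of_continuous_SUN (φ.continuous.pow 2) _)
          ((integrable_of_continuous_SUN ((continuous_restrict hpn).pow 2) _).const_mul _) fun g => ?_
        simp only [hφ, resCM, ContinuousMap.coe_mk, mul_pow]
        exact mul_le_mul_of_nonneg_right (by
          rw [← sq_abs]; exact pow_le_pow_left₀ (abs_nonneg _) (hCW g) 2) (sq_nonneg _)
      calc Real.sqrt (∫ g : SUN N, φ g ^ 2 ∂(haarSU N)) ≤ Real.sqrt (CW ^ 2 * ‖w‖ ^ 2) :=
            Real.sqrt_le_sqrt (h2.trans (mul_le_mul_of_nonneg_left (hbd n) (sq_nonneg _)))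
        _ = CW * ‖w‖ := by rw [Real.sqrt_mul (sq_nonneg _), Real.sqrt_sq hCW0, Real.sqrt_sq (norm_nonneg _)]
    have hxn : ‖x‖ = Real.sqrt (∫ g : SUN N, (p n g - w g) ^ 2 ∂(haarSU N)) := by
      rw [hx, ← Real.sqrt_sq (norm_nonneg (toL2 (resPoly n ⟨p n, hp n⟩) - w)), norm_toL2_sub_sq]; rfl
    rw [hd n, hid n]
    calc -∫ g : SUN N, w g * (W g * p n g) ∂(haarSU N) + ∫ g : SUN N, W g * p n g ^ 2 ∂(haarSU N)
        = ∫ g : SUN N, φ g * x g ∂(haarSU N) := by rw [← hWp]; ring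
      _ ≤ |∫ g : SUN N, φ g * x g ∂(haarSU N)| := le_abs_self _
      _ ≤ Real.sqrt (∫ g : SUN N, φ g ^ 2 ∂(haarSU N)) * ‖x‖ := hcs
      _ ≤ CW * ‖w‖ * Real.sqrt (∫ g : SUN N, (p n g - w g) ^ 2 ∂(haarSU N)) := by
          rw [hxn]; exact mul_le_mul_of_nonneg_right hφbd (Real.sqrt_nonneg _)
  have hTlim : Tendsto (fun n => ∫ g : SUN N, Real.exp (S g) * Gam (q n) (q n) g ∂(haarSU N)) atTop (𝓝 0) := by
    have hup : Tendsto (fun n => CW * ‖w‖ * Real.sqrt (∫ g : SUN N, (p n g - w g) ^ 2 ∂(haarSU N))) atTop (𝓝 0) := by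
      have := ((Real.continuous_sqrt.tendsto 0).comp hconv).const_mul (CW * ‖w‖)
      simpa using this
    exact tendsto_of_tendsto_of_tendsto_of_le_of_le tendsto_const_nhds hup hT0 hTle
  -- (g) Poincaré for the Haar measure applied to `q n`
  set μn : ℕ → ℝ := fun n => ∫ g : SUN N, q n g ∂(haarSU N) with hμn
  have hD : Tendsto (fun n => ∫ g : SUN N, (q n g - μn n) ^ 2 ∂(haarSU N)) atTop (𝓝 0) := by
    have hN2 : 0 < (N : ℝ) / 2 := div_pos (Nat.cast_pos.2 (Nat.pos_of_ne_zero hN)) two_pos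
    have hle : ∀ n, ∫ g : SUN N, (q n g - μn n) ^ 2 ∂(haarSU N) ≤
        (2 / N * CS) * ∫ g : SUN N, Real.exp (S g) * Gam (q n) (q n) g ∂(haarSU N) := by
      intro n
      have h1 := poincare_haar hN (hq n)
      have h2 : ∫ g : SUN N, Gam (q n) (q n) g ∂(haarSU N) ≤
          CS * ∫ g : SUN N, Real.exp (S g) * Gam (q n) (q n) g ∂(haarSU N) := by
        rw [← integral_const_mul]
        refine integral_mono (integrable_of_continuous_SUN (continuous_restrict (contDiff_Gam (hq n) (hq n))) _)
          ((integrable_of_continuous_SUN ((Real.continuous_exp.comp hSc).mul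
            (continuous_restrict (contDiff_Gam (hq n) (hq n)))) _).const_mul _) fun g => ?_
        have hΓ := Gam_self_nonneg (q n) (g : Matrix (Fin N) (Fin N) ℂ)
        calc Gam (q n) (q n) g = Real.exp (-S g) * (Real.exp (S g) * Gam (q n) (q n) g) := by
              rw [← mul_assoc, ← Real.exp_add, show -S g + S g = 0 by ring, Real.exp_zero, one_mul]
          _ ≤ CS * (Real.exp (S g) * Gam (q n) (q n) g) :=
              mul_le_mul_of_nonneg_right (hCS g) (mul_nonneg (Real.exp_pos _).le hΓ)
      calc ∫ g : SUN N, (q n g - μn n) ^ 2 ∂(haarSU N)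
          = (2 / N) * ((N : ℝ) / 2 * ∫ g : SUN N, (q n g - μn n) ^ 2 ∂(haarSU N)) := by
            field_simp
        _ ≤ (2 / N) * (CS * ∫ g : SUN N, Real.exp (S g) * Gam (q n) (q n) g ∂(haarSU N)) :=
            mul_le_mul_of_nonneg_left (h1.trans h2) (by positivity)
        _ = (2 / N * CS) * ∫ g : SUN N, Real.exp (S g) * Gam (q n) (q n) g ∂(haarSU N) := by ring
    have hup : Tendsto (fun n => (2 / N * CS) * ∫ g : SUN N, Real.exp (S g) * Gam (q n) (q n) g ∂(haarSU N))
        atTop (𝓝 0) := by simpa using hTlim.const_mul (2 / N * CS)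
    exact tendsto_of_tendsto_of_tendsto_of_le_of_le tendsto_const_nhds hup
      (fun n => integral_nonneg fun g => sq_nonneg _) hle
  -- (h) `q n → e^{-S/2} w` in `L²(σ)`
  set qf : SUN N → ℝ := fun g => Real.exp (-S g / 2) * w g with hqf
  have hqf_mem : MemLp qf 2 (haarSU N) := by
    have hb : MemLp (fun g : SUN N => Real.exp (-S g / 2)) (⊤ : ENNReal) (haarSU N) := by
      have hc : Continuous fun g : SUN N => Real.exp (-S g / 2) := Real.continuous_exp.comp (hSc.neg.div_const 2)
      obtain ⟨C, hC⟩ := (isCompact_univ (X := SUN N)).exists_bound_of_continuousOn hc.continuousOn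
      exact memLp_top_of_bound hc.aestronglyMeasurable C (ae_of_all _ fun g => hC g (Set.mem_univ _))
    exact MemLp.mul' (Lp.memLp w) hb
  set Qf : Lp ℝ 2 (haarSU N) := hqf_mem.toLp qf with hQf
  have hQf_coe : (fun g => Qf g) =ᵐ[haarSU N] qf := hqf_mem.coeFn_toLp
  have hQn : Tendsto (fun n => ‖toL2 (resCM (q n) (continuous_restrict (hq n))) - Qf‖ ^ 2) atTop (𝓝 0) := by
    have hle : ∀ n, ‖toL2 (resCM (q n) (continuous_restrict (hq n))) - Qf‖ ^ 2 ≤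
        CS * ∫ g : SUN N, (p n g - w g) ^ 2 ∂(haarSU N) := by
      intro n
      rw [norm_sq_eq_integral, ← integral_const_mul]
      refine integral_mono_ae (integrable_sq_L2 _) ((((integrable_sq_L2 (toL2 (resPoly n ⟨p n, hp n⟩) - w)).const_mul CS)).congr ?_) ?_
      · filter_upwards [Lp.coeFn_sub (toL2 (resPoly n ⟨p n, hp n⟩)) w,
          ContinuousMap.coeFn_toLp (p := 2) (μ := haarSU N) (𝕜 := ℝ) (resPoly n ⟨p n, hp n⟩)] with g hsub hres
        rw [hsub, Pi.sub_apply, hres, resPoly_apply]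
      · filter_upwards [Lp.coeFn_sub (toL2 (resCM (q n) (continuous_restrict (hq n)))) Qf, hQf_coe,
          ContinuousMap.coeFn_toLp (p := 2) (μ := haarSU N) (𝕜 := ℝ) (resCM (q n) (continuous_restrict (hq n)))]
          with g hsub hQ hres
        rw [hsub, Pi.sub_apply, hQ, hres]
        simp only [resCM, ContinuousMap.coe_mk, hqdef, hqf]
        rw [← mul_sub, mul_pow]
        refine mul_le_mul_of_nonneg_right ?_ (sq_nonneg _)
        rw [← Real.exp_nat_mul]; norm_num
        rw [show (2 : ℝ) * (-S g / 2) = -S g by ring]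
        exact hCS g
    have hup : Tendsto (fun n => CS * ∫ g : SUN N, (p n g - w g) ^ 2 ∂(haarSU N)) atTop (𝓝 0) := by
      simpa using hconv.const_mul CS
    exact tendsto_of_tendsto_of_tendsto_of_le_of_le tendsto_const_nhds hup (fun n => sq_nonneg _) hle
  -- (i) the constants `μ n` converge to `Qf` in `L²`
  have hCn : Tendsto (fun n => cL (μn n)) atTop (𝓝 Qf) := by
    rw [tendsto_iff_norm_sub_tendsto_zero]
    have h1 : ∀ n, ‖cL (μn n) - Qf‖ ≤ Real.sqrt (∫ g : SUN N, (q n g - μn n) ^ 2 ∂(haarSU N)) +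
        Real.sqrt (‖toL2 (resCM (q n) (continuous_restrict (hq n))) - Qf‖ ^ 2) := by
      intro n
      have e1 : Real.sqrt (∫ g : SUN N, (q n g - μn n) ^ 2 ∂(haarSU N)) =
          ‖toL2 (resCM (q n) (continuous_restrict (hq n))) - cL (μn n)‖ := by
        rw [← Real.sqrt_sq (norm_nonneg (toL2 (resCM (q n) (continuous_restrict (hq n))) - cL (μn n))),
          norm_toL2_sub_cL_sq]; rfl
      rw [e1, Real.sqrt_sq (norm_nonneg _), ← norm_neg (toL2 _ - cL (μn n)), neg_sub]
      exact norm_sub_le_norm_sub_add_norm_sub _ _ _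
    have h2 : Tendsto (fun n => Real.sqrt (∫ g : SUN N, (q n g - μn n) ^ 2 ∂(haarSU N)) +
        Real.sqrt (‖toL2 (resCM (q n) (continuous_restrict (hq n))) - Qf‖ ^ 2)) atTop (𝓝 0) := by
      have := ((Real.continuous_sqrt.tendsto 0).comp hD).add ((Real.continuous_sqrt.tendsto 0).comp hQn)
      simpa using this
    exact tendsto_of_tendsto_of_tendsto_of_le_of_le tendsto_const_nhds h2 (fun n => norm_nonneg _) h1
  obtain ⟨m, hm⟩ := ae_eq_const_of_tendsto_cL Qf μn hCn
  refine ⟨m, ?_⟩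
  filter_upwards [hm, hQf_coe] with g h1 h2
  have h3 : qf g = m := by rw [← h2]; exact h1
  simp only [hqf] at h3
  calc w g = Real.exp (S g / 2) * (Real.exp (-S g / 2) * w g) := by
        rw [← mul_assoc, exp_half_mul_exp_neg_half, one_mul]
    _ = m * Real.exp (S g / 2) := by rw [h3, mul_comm]

end Summit.QuantumFields.YangMills.Theorems.EguchiKawaiDirectionLadder
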